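import Summits.Ventures.Crystal3D.Theorems.StickyWulffConstantPolycrystalWulffBoundCommonBond

/-!
# A single-axis colony carries THREE admissible (bond, `⟨112⟩`) pairs
# (`PolycrystalWulffBound`, line `PolyDensity`, crux `stmt-Ventures-19482`)

Route `StickyWulffConstant` of the venture `Summits/Ventures/Crystal3D`, second prover lane (poly-p2,
gen 11).  The disc-form twin gap (`supportFn_le_twin_disc`), the flip-a-class rung
(`rung_singleAxis_texture_flipClass`), the hybrid rung and `supportFn_cruxWulffBody_le_of_Ax` take THREE
pairs `(u, w), (u₂, w₂), (u₃, w₃)` — horizontal nearest-neighbour bonds `u_k` of every grain's lattice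
(with the mirror `⊥ u_k` a lattice symmetry) and the `⟨112⟩` unit vectors `w_k ⊥ m, u_k` at `120°`
(`w₂ = (√3/2)u − w/2`, `w₃ = −(√3/2)u − w/2`).  `exists_three_admissible_pairs`: frames pairwise
co-axial about `m` (crux clause `Ax m`) HAVE such a triple — the images under the witnessing frame `L₀`
of `½𝐮, ½𝐯, ½(𝐮 − 𝐯)` (every grain realises the whole half hexagon, `image_halfHex_subset_lattice`;
mirrors by `reflection_image_lattice_eq_of_bond`).  So all lattice hypotheses of those rungs reduce to
`∀ f g, Ax m (A f) (A g)`.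
WHAT THIS IS NOT: anything about energies; the crux is not claimed.
-/

noncomputable section

open scoped BigOperators InnerProductSpace
open Set

namespace Summit.Ventures.Crystal3D.Theorems

open Summit.Ventures.Crystal3D.Cruxes.TextureLiminf.TexShadow (E3)
open Literature.MathematicalPhysics.StatisticalMechanics (fccStacking barlowStacking IsHaggSeq fccHost
  barlowShell barlowShell_one_neg_one_eq triangularVec₁ triangularVec₂ zero_mem_fccHost)
open Literature.Geometry.DiscreteGeometry (hexagonSet hexagonSet_subset_layerShell apply_two_of_mem_hexagonSet
  frameU_apply_zero frameU_apply_one frameU_apply_two frameV_apply_zero frameV_apply_one frameV_apply_two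
  inner_frameU_frameU inner_frameU_frameV)

/-- Half-hexagon vectors are unit vectors of the reference lattice. -/
theorem halfHex_mem_unitShell {x : E3} (hx : x ∈ hexagonSet) :
    (2 : ℝ)⁻¹ • x ∈ {w : E3 | w ∈ fccStacking 1 (Real.sqrt (2 / 3)) ∧ ‖w‖ = 1} := by
  have hmem : (2 : ℝ)⁻¹ • x ∈ barlowShell 1 (-1) := ⟨x, hexagonSet_subset_layerShell 1 (-1) hx, rfl⟩
  exact barlowShell_one_neg_one_eq ▸ hmem

/-- **Three admissible (bond, `⟨112⟩`) pairs for a single-axis colony.** -/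
theorem exists_three_admissible_pairs {k : ℕ} (A : Fin k → (E3 ≃ₗᵢ[ℝ] E3)) {m : E3}
    (hAx : ∀ f g, ∃ (L : E3 ≃ₗᵢ[ℝ] E3) (s₁ s₂ : E3) (σ σ' : ℤ → ℤ), IsHaggSeq σ ∧ IsHaggSeq σ' ∧
      L (EuclideanSpace.single (2 : Fin 3) (1 : ℝ)) = m ∧
      A f '' fccStacking 1 (Real.sqrt (2 / 3)) ⊆
        (fun q => L q + s₁) '' barlowStacking 1 (Real.sqrt (2 / 3)) σ ∧
      A g '' fccStacking 1 (Real.sqrt (2 / 3)) ⊆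
        (fun q => L q + s₂) '' barlowStacking 1 (Real.sqrt (2 / 3)) σ')
    (f₀ : Fin k) :
    ∃ u w u₂ w₂ u₃ w₃ : E3, ‖u‖ = 1 ∧ ‖w‖ = 1 ∧ ⟪u, m⟫_ℝ = 0 ∧ ⟪w, m⟫_ℝ = 0 ∧ ⟪w, u⟫_ℝ = 0 ∧
      w₂ = (Real.sqrt 3 / 2) • u - (1 / 2 : ℝ) • w ∧ w₃ = -(Real.sqrt 3 / 2) • u - (1 / 2 : ℝ) • w ∧
      ‖u₂‖ = 1 ∧ ⟪u₂, m⟫_ℝ = 0 ∧ ⟪w₂, u₂⟫_ℝ = 0 ∧ ‖u₃‖ = 1 ∧ ⟪u₃, m⟫_ℝ = 0 ∧ ⟪w₃, u₃⟫_ℝ = 0 ∧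
      (∀ f, u ∈ A f '' fccStacking 1 (Real.sqrt (2 / 3))) ∧
      (∀ f, (ℝ ∙ u)ᗮ.reflection '' (A f '' fccStacking 1 (Real.sqrt (2 / 3))) =
        A f '' fccStacking 1 (Real.sqrt (2 / 3))) ∧
      (∀ f, u₂ ∈ A f '' fccStacking 1 (Real.sqrt (2 / 3))) ∧
      (∀ f, (ℝ ∙ u₂)ᗮ.reflection '' (A f '' fccStacking 1 (Real.sqrt (2 / 3))) =
        A f '' fccStacking 1 (Real.sqrt (2 / 3))) ∧
      (∀ f, u₃ ∈ A f '' fccStacking 1 (Real.sqrt (2 / 3))) ∧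
      (∀ f, (ℝ ∙ u₃)ᗮ.reflection '' (A f '' fccStacking 1 (Real.sqrt (2 / 3))) =
        A f '' fccStacking 1 (Real.sqrt (2 / 3))) := by
  obtain ⟨L₀, s₁, -, σ, -, hσ, -, hL₀m, hS₀, -⟩ := hAx f₀ f₀
  -- every half-hexagon vector, pushed by `L₀`, is a horizontal unit bond of EVERY grain
  have hgen : ∀ x ∈ hexagonSet, ‖L₀ ((2 : ℝ)⁻¹ • x)‖ = 1 ∧ ⟪L₀ ((2 : ℝ)⁻¹ • x), m⟫_ℝ = 0 ∧
      ∀ f, L₀ ((2 : ℝ)⁻¹ • x) ∈ A f '' fccStacking 1 (Real.sqrt (2 / 3)) := by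
    intro x hx
    have hyH : (2 : ℝ)⁻¹ • x ∈ (fun x : E3 => (2 : ℝ)⁻¹ • x) '' hexagonSet := ⟨x, hx, rfl⟩
    have hn : ‖L₀ ((2 : ℝ)⁻¹ • x)‖ = 1 := by
      rw [LinearIsometryEquiv.norm_map]; exact (halfHex_mem_unitShell hx).2
    have hm' : ⟪L₀ ((2 : ℝ)⁻¹ • x), m⟫_ℝ = 0 := by
      rw [← hL₀m, LinearIsometryEquiv.inner_map_map, EuclideanSpace.inner_single_right]
      simp [apply_two_of_mem_hexagonSet hx]
    refine ⟨hn, hm', fun f => ?_⟩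
    obtain ⟨L, t₁, t₂, σ₁, σ₂, hσ₁, hσ₂, hLm, hS₁, hS₂⟩ := hAx f₀ f
    have h0 : (0 : E3) ∈ A f₀ '' fccStacking 1 (Real.sqrt (2 / 3)) :=
      ⟨0, zero_mem_fccHost, map_zero (A f₀)⟩
    have hu₀ : L₀ ((2 : ℝ)⁻¹ • x) ∈ A f₀ '' fccStacking 1 (Real.sqrt (2 / 3)) :=
      image_halfHex_subset_lattice hσ hL₀m hS₀ (hAx f₀ f₀) ⟨(2 : ℝ)⁻¹ • x, hyH, rfl⟩
    have huL : L₀ ((2 : ℝ)⁻¹ • x) ∈ L '' ((fun x : E3 => (2 : ℝ)⁻¹ • x) '' hexagonSet) :=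
      horizontal_unit_mem_image_halfHex hσ₁ hLm h0 hS₁ hu₀ hn hm'
    exact image_halfHex_subset_lattice hσ₂ hLm hS₂ (hAx f f) huL
  -- the three bonds and the frame direction `w`
  have hU : triangularVec₁ (2 : ℝ) ∈ hexagonSet := by simp [hexagonSet]
  have hV : triangularVec₂ (2 : ℝ) ∈ hexagonSet := by simp [hexagonSet]
  have hUV : triangularVec₁ (2 : ℝ) - triangularVec₂ (2 : ℝ) ∈ hexagonSet := by simp [hexagonSet]
  obtain ⟨hu1, hum, hub⟩ := hgen _ hU
  obtain ⟨hu₂1, hu₂m, hu₂b⟩ := hgen _ hV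
  obtain ⟨hu₃1, hu₃m, hu₃b⟩ := hgen _ hUV
  set y₁ : E3 := (2 : ℝ)⁻¹ • triangularVec₁ (2 : ℝ) with hy₁
  set y₂ : E3 := (2 : ℝ)⁻¹ • triangularVec₂ (2 : ℝ) with hy₂
  set y₃ : E3 := (2 : ℝ)⁻¹ • (triangularVec₁ (2 : ℝ) - triangularVec₂ (2 : ℝ)) with hy₃
  set wr : E3 := EuclideanSpace.single (1 : Fin 3) (1 : ℝ) with hwr
  -- reference inner products
  have h3 : Real.sqrt 3 ^ 2 = 3 := Real.sq_sqrt (by norm_num)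
  have i11 : ⟪y₁, y₂⟫_ℝ = 1 / 2 := by
    rw [hy₁, hy₂, real_inner_smul_left, real_inner_smul_right, inner_frameU_frameV]; norm_num
  have i13 : ⟪y₁, y₃⟫_ℝ = 1 / 2 := by
    rw [hy₁, hy₃, real_inner_smul_left, real_inner_smul_right, inner_sub_right, inner_frameU_frameU,
      inner_frameU_frameV]; norm_num
  have iw1 : ⟪wr, y₁⟫_ℝ = 0 := by
    rw [hwr, hy₁, EuclideanSpace.inner_single_left]; simp [frameU_apply_one]
  have iw2 : ⟪wr, y₂⟫_ℝ = Real.sqrt 3 / 2 := by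
    rw [hwr, hy₂, EuclideanSpace.inner_single_left]; simp [frameV_apply_one]; ring
  have iw3 : ⟪wr, y₃⟫_ℝ = -(Real.sqrt 3 / 2) := by
    rw [hwr, hy₃, EuclideanSpace.inner_single_left]; simp [frameU_apply_one, frameV_apply_one]; ring
  have iwr : ‖wr‖ = 1 := by rw [hwr, PiLp.norm_single, norm_one]
  have iwm : ⟪L₀ wr, m⟫_ℝ = 0 := by
    rw [← hL₀m, LinearIsometryEquiv.inner_map_map, hwr, EuclideanSpace.inner_single_left]; simp
  refine ⟨L₀ y₁, L₀ wr, L₀ y₂, (Real.sqrt 3 / 2) • L₀ y₁ - (1 / 2 : ℝ) • L₀ wr, L₀ y₃,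
    -(Real.sqrt 3 / 2) • L₀ y₁ - (1 / 2 : ℝ) • L₀ wr, hu1, ?_, hum, iwm, ?_, rfl, rfl, hu₂1, hu₂m, ?_,
    hu₃1, hu₃m, ?_, hub, fun f => reflection_image_lattice_eq_of_bond (A f) (hub f) hu1, hu₂b,
    fun f => reflection_image_lattice_eq_of_bond (A f) (hu₂b f) hu₂1, hu₃b,
    fun f => reflection_image_lattice_eq_of_bond (A f) (hu₃b f) hu₃1⟩
  · rw [LinearIsometryEquiv.norm_map, iwr]
  · rw [LinearIsometryEquiv.inner_map_map, iw1]
  · rw [inner_sub_left, real_inner_smul_left, real_inner_smul_left, LinearIsometryEquiv.inner_map_map,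
      LinearIsometryEquiv.inner_map_map, i11, iw2]; ring
  · rw [inner_sub_left, real_inner_smul_left, real_inner_smul_left,
      LinearIsometryEquiv.inner_map_map, LinearIsometryEquiv.inner_map_map, i13, iw3]; ring

end Summit.Ventures.Crystal3D.Theorems

end
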